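import Mathlib

/-!
# `SnSubsetDichotomy.ThresholdSubsetTriples`, line `SketchIdeator6` (genus / Riemann–Hurwitz certificate) — stub `stub_rhSwap`

Registered stub `stub_rhSwap` of the lead skeleton (crux `stmt-MatrixMultiplication-10882`).
Multiplying a permutation by a transposition splits one cycle or merges two (set-level description of the new cycle relation and the cycle count).
-/

namespace Summit.MatrixMultiplication.MatrixMultiplication.Theorems.ThresholdSubsetTriples

open Equiv Equiv.Perm

/-- Powers of `swap a b * π` and of `π` agree at `x` as long as the `π`-trajectory of `x`
has not passed through `a` or `b` (at a positive time `≤ n`). -/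
private theorem rh_pow_apply_eq_of_forall_ne {α : Type*} [DecidableEq α] (π : Perm α)
    (a b x : α) (n : ℕ)
    (h : ∀ i, 0 < i → i ≤ n → (π ^ i) x ≠ a ∧ (π ^ i) x ≠ b) :
    ((swap a b * π) ^ n) x = (π ^ n) x := by
  induction n with
  | zero => simp
  | succ n ih =>
    obtain ⟨ha, hb⟩ := h (n + 1) (Nat.succ_pos n) le_rfl
    simp only [pow_succ', Perm.mul_apply] at ha hb ⊢
    rw [ih (fun i hi hin => h i hi (Nat.le_succ_of_le hin))]
    exact swap_apply_of_ne_of_ne ha hb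

/-- If `(π ^ p) x = x` then `(π ^ n) x` only depends on `n % p`. -/
private theorem rh_pow_apply_mod {α : Type*} (π : Perm α) {x : α} {p : ℕ}
    (hp : (π ^ p) x = x) (n : ℕ) : (π ^ n) x = (π ^ (n % p)) x := by
  conv_lhs => rw [← Nat.mod_add_div n p, pow_add, pow_mul, Perm.mul_apply,
    pow_apply_eq_self_of_apply_eq_self hp]

/-- Outside the `π`-cycles of `a` and `b`, the cycles of `swap a b * π` and of `π` coincide. -/
private theorem rh_sameCycle_iff_of_not {α : Type*} [DecidableEq α] [Finite α] (π : Perm α)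
    {a b x : α} (ha : ¬ π.SameCycle a x) (hb : ¬ π.SameCycle b x) (y : α) :
    (swap a b * π).SameCycle x y ↔ π.SameCycle x y := by
  have key : ∀ n : ℕ, ((swap a b * π) ^ n) x = (π ^ n) x := fun n =>
    rh_pow_apply_eq_of_forall_ne π a b x n fun i _ _ =>
      ⟨fun h => ha (SameCycle.symm ⟨i, by simpa using h⟩),
       fun h => hb (SameCycle.symm ⟨i, by simpa using h⟩)⟩
  constructor
  · intro h
    obtain ⟨n, -, hn⟩ := h.exists_pow_eq'
    rw [key] at hn
    exact ⟨n, by simpa using hn⟩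
  · intro h
    obtain ⟨n, -, hn⟩ := h.exists_pow_eq'
    rw [← key] at hn
    exact ⟨n, by simpa using hn⟩

/-- A `ρ`-stable predicate holding at `a` and at `b` is stable along the cycles of
`swap a b * ρ`. -/
private theorem rh_sameCycle_inv {α : Type*} [DecidableEq α] [Finite α] {ρ : Perm α} {a b : α}
    {S : α → Prop} (hS : ∀ y, S y → S (ρ y)) (ha : S a) (hb : S b) {x y : α} (hx : S x)
    (h : (swap a b * ρ).SameCycle x y) : S y := by
  have key : ∀ n : ℕ, S (((swap a b * ρ) ^ n) x) := by
    intro n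
    induction n with
    | zero => simpa using hx
    | succ n ih =>
      rw [pow_succ', Perm.mul_apply, Perm.mul_apply]
      rcases eq_or_ne (ρ (((swap a b * ρ) ^ n) x)) a with h1 | h1
      · rw [h1, swap_apply_left]; exact hb
      rcases eq_or_ne (ρ (((swap a b * ρ) ^ n) x)) b with h2 | h2
      · rw [h2, swap_apply_right]; exact ha
      rw [swap_apply_of_ne_of_ne h1 h2]
      exact hS _ ih
  obtain ⟨n, -, rfl⟩ := h.exists_pow_eq'
  exact key n

/-- Merge: if `a` and `b` lie in different cycles of `π`, they lie in one cycle of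
`swap a b * π`. -/
private theorem rh_sameCycle_swap_mul {α : Type*} [DecidableEq α] [Finite α] (π : Perm α)
    {a b : α} (hab : ¬ π.SameCycle a b) : (swap a b * π).SameCycle a b := by
  classical
  have hex : ∃ n : ℕ, 0 < n ∧ (π ^ n) a = a := by
    obtain ⟨n, hn, -, h⟩ := (SameCycle.refl π a).exists_pow_eq''
    exact ⟨n, hn, h⟩
  -- `p` is the first return time of `a` under `π`
  obtain ⟨p, ⟨hp0, hpa⟩, hmin⟩ :
      ∃ p, (0 < p ∧ (π ^ p) a = a) ∧ ∀ m, m < p → ¬ (0 < m ∧ (π ^ m) a = a) :=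
    ⟨Nat.find hex, Nat.find_spec hex, fun m hm => Nat.find_min hex hm⟩
  obtain ⟨q, rfl⟩ := Nat.exists_eq_succ_of_ne_zero hp0.ne'
  have hagree : ((swap a b * π) ^ q) a = (π ^ q) a :=
    rh_pow_apply_eq_of_forall_ne π a b a q fun i hi hiq =>
      ⟨fun h => hmin i (Nat.lt_succ_of_le hiq) ⟨hi, h⟩,
        fun h => hab ⟨i, by simpa using h⟩⟩
  rw [pow_succ', Perm.mul_apply] at hpa
  refine ⟨((q + 1 : ℕ) : ℤ), ?_⟩
  rw [zpow_natCast, pow_succ', Perm.mul_apply, hagree, Perm.mul_apply, hpa, swap_apply_left]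

/-- Split: if `a ≠ b` lie in one cycle of `π`, they lie in different cycles of
`swap a b * π`. -/
private theorem rh_not_sameCycle_swap_mul {α : Type*} [DecidableEq α] [Finite α] (π : Perm α)
    {a b : α} (hne : a ≠ b) (hab : π.SameCycle a b) : ¬ (swap a b * π).SameCycle a b := by
  classical
  have hex : ∃ n : ℕ, (π ^ n) a = b := by
    obtain ⟨n, -, h⟩ := hab.exists_pow_eq'
    exact ⟨n, h⟩
  -- `k` is the first hitting time of `b` from `a` under `π`
  obtain ⟨k, hk, hmin⟩ : ∃ k, (π ^ k) a = b ∧ ∀ m, m < k → (π ^ m) a ≠ b :=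
    ⟨Nat.find hex, Nat.find_spec hex, fun m hm => Nat.find_min hex hm⟩
  have hk0 : k ≠ 0 := by
    rintro rfl
    rw [pow_zero, Perm.one_apply] at hk
    exact hne hk
  obtain ⟨q, rfl⟩ := Nat.exists_eq_succ_of_ne_zero hk0
  -- no return to `a` before time `q + 1`
  have hper : ∀ i, 0 < i → i ≤ q → (π ^ i) a ≠ a := by
    intro i hi hiq h
    have h1 := rh_pow_apply_mod π h (q + 1)
    rw [hk] at h1
    exact hmin ((q + 1) % i) (lt_of_lt_of_le (Nat.mod_lt _ hi) (Nat.le_succ_of_le hiq)) h1.symm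
  have hagree : ∀ j, j ≤ q → ((swap a b * π) ^ j) a = (π ^ j) a := fun j hj =>
    rh_pow_apply_eq_of_forall_ne π a b a j fun i hi hij =>
      ⟨hper i hi (hij.trans hj), hmin i (Nat.lt_succ_of_le (hij.trans hj))⟩
  have hback : ((swap a b * π) ^ (q + 1)) a = a := by
    rw [pow_succ', Perm.mul_apply, hagree q le_rfl, Perm.mul_apply]
    rw [pow_succ', Perm.mul_apply] at hk
    rw [hk, swap_apply_right]
  intro H
  obtain ⟨n, -, hn⟩ := H.exists_pow_eq'
  rw [rh_pow_apply_mod _ hback n,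
    hagree _ (Nat.le_of_lt_succ (Nat.mod_lt _ (Nat.succ_pos q)))] at hn
  exact hmin _ (Nat.mod_lt _ (Nat.succ_pos q)) hn

/-- Merge: the cycle of `a` for `swap a b * π` is the union of the `π`-cycles of `a` and `b`. -/
private theorem rh_sameCycle_swap_mul_iff {α : Type*} [DecidableEq α] [Finite α] (π : Perm α)
    {a b : α} (hab : ¬ π.SameCycle a b) (x : α) :
    (swap a b * π).SameCycle a x ↔ (π.SameCycle a x ∨ π.SameCycle b x) := by
  have hab' := rh_sameCycle_swap_mul π hab
  constructor
  · intro h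
    exact rh_sameCycle_inv (ρ := π) (S := fun y => π.SameCycle a y ∨ π.SameCycle b y)
      (fun y hy => hy.imp sameCycle_apply_right.2 sameCycle_apply_right.2)
      (Or.inl (SameCycle.refl π a)) (Or.inr (SameCycle.refl π b)) (Or.inl (SameCycle.refl π a)) h
  · have hS : ∀ y, (swap a b * π).SameCycle a y →
        (swap a b * π).SameCycle a ((swap a b * π) y) :=
      fun y hy => sameCycle_apply_right.2 hy
    rintro (h | h)
    · exact rh_sameCycle_inv (ρ := swap a b * π) (S := fun y => (swap a b * π).SameCycle a y)
        hS (SameCycle.refl _ a) hab' (SameCycle.refl _ a) (by rwa [swap_mul_self_mul])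
    · exact rh_sameCycle_inv (ρ := swap a b * π) (S := fun y => (swap a b * π).SameCycle a y)
        hS (SameCycle.refl _ a) hab' hab' (by rwa [swap_mul_self_mul])

/-- The orbit relation of the cyclic group generated by `π` is the relation `SameCycle π`. -/
private theorem rh_orbitRel_iff {α : Type*} (π : Perm α) (x y : α) :
    MulAction.orbitRel (Subgroup.zpowers π) α x y ↔ π.SameCycle x y := by
  rw [MulAction.orbitRel_apply, MulAction.mem_orbit_iff]
  constructor
  · rintro ⟨⟨g, hg⟩, hgx⟩
    obtain ⟨k, rfl⟩ := Subgroup.mem_zpowers_iff.mp hg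
    exact SameCycle.symm ⟨k, hgx⟩
  · intro h
    obtain ⟨k, hk⟩ := h.symm
    exact ⟨⟨π ^ k, Subgroup.zpow_mem_zpowers π k⟩, hk⟩

/-- Merging two distinct classes of an equivalence relation on a finite type removes exactly
one class. -/
private theorem rh_card_quotient_merge {β : Type*} [Finite β] (r₁ r₂ : Setoid β) (a b : β)
    (hab : ¬ r₁ a b) (hab' : r₂ a b) (h12 : ∀ x y, r₁ x y → r₂ x y)
    (h21 : ∀ x y, r₂ x y → r₁ x y ∨ (r₁ a x ∧ r₁ b y) ∨ (r₁ b x ∧ r₁ a y)) :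
    Nat.card (Quotient r₂) + 1 = Nat.card (Quotient r₁) := by
  classical
  -- the identity induces a bijection from the `r₁`-classes other than that of `b`
  -- onto the `r₂`-classes
  let f : {c : Quotient r₁ // c ≠ Quotient.mk r₁ b} → Quotient r₂ := fun c =>
    Quotient.lift (fun x => Quotient.mk r₂ x) (fun x y h => Quotient.sound (h12 x y h)) c.1
  have hf : Function.Bijective f := by
    constructor
    · rintro ⟨c₁, hc₁⟩ ⟨c₂, hc₂⟩ h
      obtain ⟨x, rfl⟩ := Quotient.exists_rep c₁
      obtain ⟨y, rfl⟩ := Quotient.exists_rep c₂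
      have hxy : r₂ x y := Quotient.exact h
      rcases h21 x y hxy with h | ⟨-, h⟩ | ⟨h, -⟩
      · exact Subtype.ext (Quotient.sound h)
      · exact absurd (Quotient.sound (Setoid.symm' r₁ h)) hc₂
      · exact absurd (Quotient.sound (Setoid.symm' r₁ h)) hc₁
    · intro c
      obtain ⟨y, rfl⟩ := Quotient.exists_rep c
      by_cases hy : Quotient.mk r₁ y = Quotient.mk r₁ b
      · refine ⟨⟨Quotient.mk r₁ a, fun h => hab (Quotient.exact h)⟩, ?_⟩
        exact Quotient.sound
          (Setoid.trans' r₂ hab' (h12 _ _ (Setoid.symm' r₁ (Quotient.exact hy))))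
      · exact ⟨⟨Quotient.mk r₁ y, hy⟩, rfl⟩
  rw [(Nat.card_eq_of_bijective f hf).symm, ← Finite.card_option,
    Nat.card_congr (Equiv.optionSubtypeNe (Quotient.mk r₁ b))]

/-- Merge: `swap a b * π` has exactly one cycle fewer than `π` (cycles counted as orbits of the
cyclic group, fixed points included). -/
private theorem rh_card_merge {α : Type*} [DecidableEq α] [Finite α] (π : Perm α) {a b : α}
    (hab : ¬ π.SameCycle a b) :
    Nat.card (MulAction.orbitRel.Quotient (Subgroup.zpowers (swap a b * π)) α) + 1 =
      Nat.card (MulAction.orbitRel.Quotient (Subgroup.zpowers π) α) := by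
  refine rh_card_quotient_merge (MulAction.orbitRel (Subgroup.zpowers π) α)
    (MulAction.orbitRel (Subgroup.zpowers (swap a b * π)) α) a b ?_ ?_ ?_ ?_
  · rwa [rh_orbitRel_iff]
  · rw [rh_orbitRel_iff]
    exact rh_sameCycle_swap_mul π hab
  · intro x y hxy
    rw [rh_orbitRel_iff] at hxy ⊢
    by_cases hx : π.SameCycle a x ∨ π.SameCycle b x
    · have hy : π.SameCycle a y ∨ π.SameCycle b y :=
        hx.imp (fun h => h.trans hxy) (fun h => h.trans hxy)
      exact ((rh_sameCycle_swap_mul_iff π hab x).2 hx).symm.trans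
        ((rh_sameCycle_swap_mul_iff π hab y).2 hy)
    · obtain ⟨hxa, hxb⟩ := not_or.mp hx
      exact (rh_sameCycle_iff_of_not π hxa hxb y).2 hxy
  · intro x y hxy
    rw [rh_orbitRel_iff] at hxy ⊢
    simp only [rh_orbitRel_iff]
    by_cases hx : π.SameCycle a x ∨ π.SameCycle b x
    · have hx' : (swap a b * π).SameCycle a x := (rh_sameCycle_swap_mul_iff π hab x).2 hx
      have hy : π.SameCycle a y ∨ π.SameCycle b y :=
        (rh_sameCycle_swap_mul_iff π hab y).1 (hx'.trans hxy)
      rcases hx with hx | hx <;> rcases hy with hy | hy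
      · exact Or.inl (hx.symm.trans hy)
      · exact Or.inr (Or.inl ⟨hx, hy⟩)
      · exact Or.inr (Or.inr ⟨hx, hy⟩)
      · exact Or.inl (hx.symm.trans hy)
    · obtain ⟨hxa, hxb⟩ := not_or.mp hx
      exact Or.inl ((rh_sameCycle_iff_of_not π hxa hxb y).1 hxy)

/-- **Stub `stub_rhSwap`.** For `a ≠ b` and `σ' = (a b)·σ`: split/merge of cycles with explicit `SameCycle` description; cycle count (orbits of the cyclic group, fixed points included) changes by exactly one. [folklore] -/
theorem stub_rhSwap : ∀ (α : Type) [Fintype α] [DecidableEq α] (σ : Equiv.Perm α) (a b : α), a ≠ b → (σ.SameCycle a b → ¬ (Equiv.swap a b * σ).SameCycle a b ∧ (∀ x y : α, ¬ σ.SameCycle a x → ((Equiv.swap a b * σ).SameCycle x y ↔ σ.SameCycle x y)) ∧ (∀ x : α, σ.SameCycle a x ↔ ((Equiv.swap a b * σ).SameCycle a x ∨ (Equiv.swap a b * σ).SameCycle b x)) ∧ Nat.card (MulAction.orbitRel.Quotient (Subgroup.zpowers (Equiv.swap a b * σ)) (α)) = Nat.card (MulAction.orbitRel.Quotient (Subgroup.zpowers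 σ) (α)) + 1) ∧ (¬ σ.SameCycle a b → (Equiv.swap a b * σ).SameCycle a b ∧ (∀ x y : α, ¬ σ.SameCycle a x → ¬ σ.SameCycle b x → ((Equiv.swap a b * σ).SameCycle x y ↔ σ.SameCycle x y)) ∧ (∀ x : α, (Equiv.swap a b * σ).SameCycle a x ↔ (σ.SameCycle a x ∨ σ.SameCycle b x)) ∧ Nat.card (MulAction.orbitRel.Quotient (Subgroup.zpowers (Equiv.swap a b * σ)) (α)) + 1 = Nat.card (MulAction.orbitRel.Quotient (Subgroup.zpowers σ) (α))) := by
  intro α _ _ σ a b hne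
  constructor
  · intro hab
    have hab' : ¬ (swap a b * σ).SameCycle a b := rh_not_sameCycle_swap_mul σ hne hab
    refine ⟨hab', ?_, ?_, ?_⟩
    · intro x y hx
      exact rh_sameCycle_iff_of_not σ hx (fun h => hx (hab.trans h)) y
    · intro x
      constructor
      · intro h
        exact rh_sameCycle_inv (ρ := swap a b * σ)
          (S := fun y => (swap a b * σ).SameCycle a y ∨ (swap a b * σ).SameCycle b y)
          (fun y hy => hy.imp sameCycle_apply_right.2 sameCycle_apply_right.2)
          (Or.inl (SameCycle.refl _ a)) (Or.inr (SameCycle.refl _ b))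
          (Or.inl (SameCycle.refl _ a)) (by rwa [swap_mul_self_mul])
      · rintro (h | h)
        · exact rh_sameCycle_inv (ρ := σ) (S := fun y => σ.SameCycle a y)
            (fun y hy => sameCycle_apply_right.2 hy) (SameCycle.refl σ a) hab
            (SameCycle.refl σ a) h
        · exact rh_sameCycle_inv (ρ := σ) (S := fun y => σ.SameCycle a y)
            (fun y hy => sameCycle_apply_right.2 hy) (SameCycle.refl σ a) hab hab h
    · have hc := rh_card_merge (swap a b * σ) hab'
      rw [swap_mul_self_mul] at hc
      exact hc.symm
  · intro hab
    refine ⟨rh_sameCycle_swap_mul σ hab, ?_, rh_sameCycle_swap_mul_iff σ hab,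
      rh_card_merge σ hab⟩
    intro x y hxa hxb
    exact rh_sameCycle_iff_of_not σ hxa hxb y

end Summit.MatrixMultiplication.MatrixMultiplication.Theorems.ThresholdSubsetTriples
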